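import Summits.KontsevichZagierPeriods.KontsevichZagierPeriods.Theses.FurushoPentagon
import Summits.KontsevichZagierPeriods.KontsevichZagierPeriods.Theorems.ReducedPeriodRing.Negative.ModelsAnatomy
import Summits.KontsevichZagierPeriods.KontsevichZagierPeriods.Theorems.FurushoPentagonReducedPeriodRingDefs
import Summits.KontsevichZagierPeriods.KontsevichZagierPeriods.Theorems.FurushoPentagonReducedPeriodRingCubeMerge
import Summits.KontsevichZagierPeriods.KontsevichZagierPeriods.Theorems.FurushoPentagonReducedPeriodRingCubeAddCovSound
import Summits.KontsevichZagierPeriods.KontsevichZagierPeriods.Theorems.FurushoPentagonReducedPeriodRingCubeNewtonLeibnizSound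
import Summits.KontsevichZagierPeriods.KontsevichZagierPeriods.Theorems.FurushoPentagonReducedPeriodRingCubeHalvingSound

/-!
# `ReducedPeriodRing` (stmt-KontsevichZagierPeriods-3929), line `effective-end-monoid`: proof skeleton v3

Lead prover's skeleton (lead `prover-line-stmt-KontsevichZagierPeriods-3929-c1-0`, continuing
`prover-line-stmt-KontsevichZagierPeriods-3929-0`). The crux `FurushoPentagon.ReducedPeriodRing`
(`c * c ∈ KZ.relations → c ∈ KZ.relations`) is derived from stubs about the CUBICAL EFFECTIVE
SUB-CALCULUS. Vocabulary (`unitCube`, `cubicalGens`, `cubicalSpan`, `cube*Rel`, `cubeMoves`,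
`cubeRelations`) = the LANDED file `Theorems/FurushoPentagonReducedPeriodRingDefs.lean` (p75688).

Stub status (v3):
* S1a `stub_cubeMerge` — LANDED p77291 (imported).
* S1b `stub_cubeResolution` — OPEN (sorry below): every representation is a `ℤ`-combination of tame
  cube classes modulo `KZ.relations`; XL (a.e. Nash cubulation / rectilinearisation).
* S2a `stub_cubeAddCov_sound` p78687, S2b `stub_cubeNewtonLeibniz_sound` p79788,
  S2c `stub_cubeHalving_sound` p76781 — LANDED (imported).
* S3 `stub_cubicalCoherence` — OPEN (sorry): a tame cube class which is a KZ relation is a CUBICAL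
  relation; XL.
* S4 `stub_cubicalSqrtClosed` — OPEN (sorry), hardest (the lead's): `[r ⊠ r] ∈ cubeRelations →
  [r] ∈ cubeRelations`.

Composition (`ReducedPeriodRing_of`, proved): `c ∼ [u]` one signed representation
(`ReducedPeriodRingNegative.exists_sub_of_mem_relations`), `[u] ∼ [r]` a tame cube class (S1b+S1a),
`[r]·[r] ∼ c·c ∈ relations` (two-sided ideal), `[r ⊠ r]` is a tame cube class (`prod_cubical`),
hence a cubical relation (S3), hence `[r] ∈ cubeRelations` (S4) `⊆ relations` (S2), hence
`c ∈ relations`.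
-/

noncomputable section

namespace Summit.KontsevichZagierPeriods.FurushoPentagon.ReducedPeriodRing

open Set
open Literature.NumberTheory.Transcendental Literature.NumberTheory.Transcendental.KZ
open Summit.KontsevichZagierPeriods.KontsevichZagierPeriods.Theses.FurushoPentagon

/-! ## Registered stubs (open) -/

/-- **S1b (resolution / compilation).** Every integral representation is, modulo the KZ relations,
a `ℤ`-combination of tame cube classes. [Ayoub 2014, Rem. 12; Viu-Sos 2021, Thm. 1.1] -/
theorem stub_cubeResolution : ∀ (N : ℕ) (u : IntegralRep N),
    ∃ c : FormalRep, c ∈ cubicalSpan ∧ of u - c ∈ relations := by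
  sorry

/-- **S3 (coherence).** A tame cube class which is a KZ relation is a cubical relation.
[Ayoub 2014, Prop. 11 (presentation comparison), rules-side analogue] -/
theorem stub_cubicalCoherence : ∀ (n : ℕ) (r : IntegralRep n), r.domain = unitCube n →
    AnalyticOnNhd ℝ r.integrand (unitCube n) → of r ∈ relations → of r ∈ cubeRelations := by
  sorry

/-- **S4 (square-root closure of the cubical relations; hardest).** If the Fubini square of a tame
cube class is a cubical relation then so is the class. [effective-end-monoid: `A_□` reduced] -/
theorem stub_cubicalSqrtClosed : ∀ (n : ℕ) (r : IntegralRep n), r.domain = unitCube n →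
    AnalyticOnNhd ℝ r.integrand (unitCube n) → of (r.prod r) ∈ cubeRelations →
    of r ∈ cubeRelations := by
  sorry

/-! ## Glue (proved) -/

/-- The cubical relations are KZ relations (S2a–c). [Kontsevich–Zagier 2001, §1.2] -/
theorem cubeRelations_le_relations : cubeRelations ≤ relations := by
  refine (AddSubgroup.closure_le _).mpr ?_
  rintro c (((hc | hc) | hc) | hc)
  · exact stub_cubeAddCov_sound (Or.inl hc)
  · exact stub_cubeNewtonLeibniz_sound hc
  · exact stub_cubeAddCov_sound (Or.inr hc)
  · exact stub_cubeHalving_sound hc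

/-- **Cube compilation** (S1b then S1a): every representation is ONE tame cube class modulo the KZ
relations. [Ayoub 2014, Rem. 12] -/
theorem cubeCompilation {N : ℕ} (u : IntegralRep N) :
    ∃ (n : ℕ) (r : IntegralRep n), r.domain = unitCube n ∧
      AnalyticOnNhd ℝ r.integrand (unitCube n) ∧ of u - of r ∈ relations := by
  obtain ⟨c, hc, huc⟩ := stub_cubeResolution N u
  obtain ⟨n, r, hd, ha, hcr⟩ := stub_cubeMerge c hc
  refine ⟨n, r, hd, ha, ?_⟩
  have := relations.add_mem huc hcr
  simpa using this

/-- The product domain of two cubes is the cube. [folklore] -/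
theorem prodDomain_eq_unitCube {n m : ℕ} (r : IntegralRep n) (s : IntegralRep m)
    (hr : r.domain = unitCube n) (hs : s.domain = unitCube m) :
    IntegralRep.prodDomain r s = unitCube (n + m) := by
  ext z
  simp only [IntegralRep.mem_prodDomain, hr, hs, mem_unitCube]
  constructor
  · rintro ⟨h1, h2⟩ i
    induction i using Fin.addCases with
    | left i => simpa using h1 i
    | right j => simpa using h2 j
  · intro h
    exact ⟨fun i => h _, fun j => h _⟩

/-- Restriction to the first `n` coordinates maps the cube to the cube. [folklore] -/
theorem castAdd_mem_unitCube {n m : ℕ} {z : Fin (n + m) → ℝ} (hz : z ∈ unitCube (n + m)) :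
    (fun i => z (Fin.castAdd m i)) ∈ unitCube n := fun _ => hz _

/-- Restriction to the last `m` coordinates maps the cube to the cube. [folklore] -/
theorem natAdd_mem_unitCube {n m : ℕ} {z : Fin (n + m) → ℝ} (hz : z ∈ unitCube (n + m)) :
    (fun j => z (Fin.natAdd n j)) ∈ unitCube m := fun _ => hz _

/-- `f ⊗ g` is analytic on a neighbourhood of the cube when `f`, `g` are. [folklore] -/
theorem analyticOnNhd_prodFun {n m : ℕ} (r : IntegralRep n) (s : IntegralRep m)
    (hr : AnalyticOnNhd ℝ r.integrand (unitCube n)) (hs : AnalyticOnNhd ℝ s.integrand (unitCube m)) :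
    AnalyticOnNhd ℝ (IntegralRep.prodFun r s) (unitCube (n + m)) := by
  -- the two coordinate restrictions are continuous linear, hence analytic everywhere
  let p₁ : (Fin (n + m) → ℝ) →L[ℝ] (Fin n → ℝ) :=
    ContinuousLinearMap.pi fun i => ContinuousLinearMap.proj (Fin.castAdd m i)
  let p₂ : (Fin (n + m) → ℝ) →L[ℝ] (Fin m → ℝ) :=
    ContinuousLinearMap.pi fun j => ContinuousLinearMap.proj (Fin.natAdd n j)
  have h₁ : AnalyticOnNhd ℝ (fun z => r.integrand (p₁ z)) (unitCube (n + m)) :=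
    hr.comp (p₁.analyticOnNhd _) fun z hz => castAdd_mem_unitCube hz
  have h₂ : AnalyticOnNhd ℝ (fun z => s.integrand (p₂ z)) (unitCube (n + m)) :=
    hs.comp (p₂.analyticOnNhd _) fun z hz => natAdd_mem_unitCube hz
  have hfun : IntegralRep.prodFun r s = fun z => r.integrand (p₁ z) * s.integrand (p₂ z) := by
    funext z
    simp [IntegralRep.prodFun, p₁, p₂]
  rw [hfun]
  exact h₁.mul h₂

/-- **The Fubini product of two tame cube classes is a tame cube class.** [Kontsevich–Zagier 2001, §4.1] -/
theorem prod_cubical {n m : ℕ} (r : IntegralRep n) (s : IntegralRep m)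
    (hrd : r.domain = unitCube n) (hra : AnalyticOnNhd ℝ r.integrand (unitCube n))
    (hsd : s.domain = unitCube m) (hsa : AnalyticOnNhd ℝ s.integrand (unitCube m)) :
    (r.prod s).domain = unitCube (n + m) ∧
      AnalyticOnNhd ℝ (r.prod s).integrand (unitCube (n + m)) := by
  refine ⟨?_, ?_⟩
  · rw [IntegralRep.prod_domain, prodDomain_eq_unitCube r s hrd hsd]
  · rw [IntegralRep.prod_integrand_eq]
    exact analyticOnNhd_prodFun r s hra hsa

/-! ## The crux -/

/-- **`ReducedPeriodRing`** from the seven stubs of line `effective-end-monoid`: the formal period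
ring `KZ.FormalRep ⧸ KZ.relations` has no nilpotents. [Kontsevich–Zagier 2001, §1.2] -/
theorem ReducedPeriodRing_of : ReducedPeriodRing := by
  intro c hcc
  -- one signed representation `u` with `c ∼ [u]`
  obtain ⟨N, u, hcu⟩ :=
    Summit.KontsevichZagierPeriods.KontsevichZagierPeriods.ReducedPeriodRingNegative.exists_sub_of_mem_relations c
  -- compile it to a tame cube class `r`
  obtain ⟨n, r, hrd, hra, hur⟩ := cubeCompilation u
  have hcr : c - of r ∈ relations := by
    have := relations.add_mem hcu hur
    simpa using this
  have hrc : of r - c ∈ relations := by simpa using relations.neg_mem hcr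
  -- `[r ⊠ r] = [r]·[r] ∼ c·c ∈ relations`
  have hsq : of (r.prod r) ∈ relations := by
    have h1 : of r * of r - c * c ∈ relations := mul_sub_mul_mem_relations hrc hrc
    have := relations.add_mem h1 hcc
    rw [of_mul_of] at this
    simpa using this
  -- `r ⊠ r` is a tame cube class, so its class is a CUBICAL relation (S3)
  obtain ⟨hpd, hpa⟩ := prod_cubical r r hrd hra hrd hra
  have hsq' : of (r.prod r) ∈ cubeRelations := stub_cubicalCoherence (n + n) (r.prod r) hpd hpa hsq
  -- square-root closure (S4) and soundness (S2)
  have hr : of r ∈ relations := cubeRelations_le_relations (stub_cubicalSqrtClosed n r hrd hra hsq')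
  have := relations.add_mem hcr hr
  simpa using this

end Summit.KontsevichZagierPeriods.FurushoPentagon.ReducedPeriodRing
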